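import Summits.AnomalousDissipation.AnomalousDissipation.Theorems.SawtoothPulseCascadeK1LocalisedCascadeLedgerGlue
import Summits.AnomalousDissipation.AnomalousDissipation.Theorems.SawtoothPulseCascadeK1LocalisedCascadeFibreSocketSharp
import Summits.AnomalousDissipation.AnomalousDissipation.Theorems.SawtoothPulseCascadeK1LocalisedCascadeFlatStripData

/-!
# K1loc, line `Spectral` / SeqCone — helper: THE H HALF-SLOT OF THE LEDGER FOR THE CASCADE FROM PROFILE DATA (capstone, SHARP Wiener weight)

Helper file of the prover lane on the crux `K1LocalisedCascade` (stmt-AnomalousDissipation-19491), route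
`SawtoothPulseCascade`.  Composition of the assembly chain for ONE H half-slot of the TRUE classical cascade scalar:
`…K1Ledger.ledger_step_H_of_moduli` (cheap inputs from first-order data) with its two per-fibre un-gauging estimates
`hfib^±` supplied by `…K1Ledger.fibre_estimate_of_profile_data'` (σ = ±1, sharp Wiener weight: `B_{r+1}/(2√3(2π)^r)`, only `D₀..D_{r+1}` enter), whose flat-strip data come from
`…K1Ledger.cascade_flatStrip_data_pos/_neg` (strip cut-offs `X^±_j = sT((±U_j′ − (1−2ε))/ε)`, exact-flat profile
`Ũ_j = affinizeU` with threshold `3ε`) and whose residual leakage comes from `…K1Ledger.leak_of_twist_moments`; the family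
disjointness / range facts of the un-gauging cut-offs are discharged by `…StripCutoff`.  Result `cascade_ledger_step_H'` (variant of `…CascadeStepH` with one derivative less in the Wiener weight, asked for by ad-k1loc-p3):
the hypothesis `hstepH` of `…K1Ledger.highModeConcentration_of_ledger[_sharp|_threshold]` at phase `j`, from PROFILE-LEVEL
data only — slot-lemma cut-offs `X̃^±` (C₁, C₂, ε₁-flatness), symbol moduli and four `ℓ¹` moments, sup bound `B`, derivative
bounds `D_k` of the strip cut-offs, shifts `b^±_n` (`|b^±_n ∓ nγ| ≤ β₀`), envelope radius `R₀`, `C^r` fibre profiles of the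
old symbol and of the squared shifted new symbol with uniform bounds, branch compatibility, twist spectral moments `≤ A_Q`.
No definitions; no statement about the stub.
[cite: BedrossianCotiZelati2017, §2] [cite: Grafakos2014, Prop. 3.1.2 (5) and Prop. 3.2.7 (3)] [problem: turb]
-/

-- `Summit.<Summit>.<Problem>`: single-conjunct summit, the duplicate namespace segment is deliberate.
set_option linter.dupNamespace false

noncomputable section

namespace Summit.AnomalousDissipation.AnomalousDissipation.Theorems.SawtoothPulseCascade.K1Ledger

open MeasureTheory Set Filter Topology UnitAddTorus Function Complex
open scoped ComplexConjugate ContDiff Nat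
open Literature.Analysis Literature.Analysis.FunctionSpaces Literature.Analysis.FunctionSpaces.Torus
open Literature.Analysis.FluidPDE.ShearStage
open Literature.Analysis.FluidPDE.SawtoothCascade Literature.Analysis.FluidPDE.SawtoothCascade.CascadeParams
open Summit.AnomalousDissipation.AnomalousDissipation.Theorems.SawtoothPulseCascade.SpectralLeakage
open Summit.AnomalousDissipation.AnomalousDissipation.Theorems.SawtoothPulseCascade.K1Slot
open Summit.AnomalousDissipation.AnomalousDissipation.Theorems.SawtoothPulseCascade.K1Cutoff

section Cascade

variable (P : CascadeParams)

/-- **The H half-slot of the energy ledger for the cascade, from profile data.**  See the module docstring; the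
conclusion is `hstepH` of the ledger theorems at phase `j` with
`εᴴ_j‖w 0‖⁻¹ = √(E₊²+E₋²) + √2·(E_slot + A⋆(β₀) + A_Q + √(2C⋆(β₀)))`, `E_σ = Σω|𝓕X̃^σ|`, and
`ζᴴ_j = 2c‖w 0‖² + M²B²·vol{X⁺+X⁻ ≠ 1} + 2(z‖w 0‖² + M²‖w 0‖(B/4)√vol{0<X⁺+X⁻<1})`.
[cite: BedrossianCotiZelati2017, §2] [cite: Grafakos2014, Prop. 3.1.2 (5) and Prop. 3.2.7 (3)] -/
theorem cascade_ledger_step_H' (hγ : 0 ≤ P.γ) (hδ₀ : 0 < P.δ₀) (hd : 0 < P.d) (j : ℕ) (hN : P.N j ≠ 0)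
    -- slot-lemma data (as in `ledger_step_H_of_moduli`)
    (Q : ShearProfile) (hQ : ∀ y, Q y = deriv (P.U j) y)
    (Xsp Xspd Xp Xsm Xsmd Xm Z : ShearProfile) (hXspd : ∀ y, Xspd y = deriv Xsp y) (hXsmd : ∀ y, Xsmd y = deriv Xsm y)
    {κ ε₁ C₁ C₂ : ℝ} (hκ : 0 ≤ κ) (hε₁ : 0 ≤ ε₁) (hγε : P.γ * ε₁ ≤ 1)
    (hXsp1 : ∀ y, |Xsp y| ≤ 1) (hXsm1 : ∀ y, |Xsm y| ≤ 1) (hpart : ∀ y, Xsp y ^ 2 + Xsm y ^ 2 ≤ 1)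
    (hC₁p : ∀ y, |Xspd y| ≤ C₁) (hC₁m : ∀ y, |Xsmd y| ≤ C₁)
    (hC₂p : ∀ y, |deriv Xspd y| ≤ C₂) (hC₂m : ∀ y, |deriv Xsmd y| ≤ C₂)
    (hflat_p : ∀ y, Xsp y ≠ 0 ∨ Xspd y ≠ 0 → |Q y - 1| ≤ ε₁)
    (hflat_m : ∀ y, Xsm y ≠ 0 ∨ Xsmd y ≠ 0 → |Q y - (-1)| ≤ ε₁)
    (hXXs_p : ∀ y, Xp y * Xsp y = Xp y) (hXXs_m : ∀ y, Xm y * Xsm y = Xm y) (hZ : ∀ y, Z y = 0)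
    -- the un-gauging cut-offs ARE the strip cut-offs of `…StripCutoff` at width `ε`
    {ε : ℝ} (hε : 0 < ε) (hε' : ε ≤ 2 / 9)
    (hXp : ∀ y, Xp y = Real.smoothTransition ((deriv (P.U j) y - (1 - 2 * ε)) / ε))
    (hXm : ∀ y, Xm y = Real.smoothTransition ((-deriv (P.U j) y - (1 - 2 * ε)) / ε))
    -- the exact-flat profile and the residual
    (Ut Qres : ShearProfile) (hUt : ∀ y, Ut y = P.U j y + ∫ t in (0 : ℝ)..y, ((1 - deriv (P.U j) t) *
        Real.smoothTransition ((deriv (P.U j) t - (1 - 2 * (3 * ε))) / (3 * ε)) +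
      (-1 - deriv (P.U j) t) * Real.smoothTransition ((-deriv (P.U j) t - (1 - 2 * (3 * ε))) / (3 * ε))))
    (hQres : ∀ y, P.γ * P.U j y = P.γ * Ut y + Qres y)
    -- the scalar, its sup bound, the symbols
    {w : ℝ → UnitAddTorus (Fin 2) → ℝ} (hw : FluidPDE.Torus.IsClassicalScalarTransportOn (Ico 0 1) κ P.field w)
    {B : ℝ} (hB : ∀ x, |w 0 x| ≤ B)
    {μ m : (Fin 2 → ℤ) → ℝ} (hμ1 : ∀ k, |μ k| ≤ 1) (hm1 : ∀ k, |m k| ≤ 1)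
    -- first-order moduli and moments (as in `ledger_step_H_of_moduli`)
    {wd wd₂ : (Fin 2 → ℤ) → ℝ} (hω0 : ∀ q, 0 ≤ wd q) (hω : ∀ k q, |μ k - μ (k - q)| ≤ wd q)
    (hω20 : ∀ q, 0 ≤ wd₂ q) (hω2 : ∀ k q, |m k ^ 2 - m (k - q) ^ 2| ≤ wd₂ q)
    (hωp : Summable fun q => wd q * ‖mFourierCoeff (fun x : UnitAddTorus (Fin 2) => (Xsp.onCircle (x 1) : ℂ)) q‖)
    (hωm : Summable fun q => wd q * ‖mFourierCoeff (fun x : UnitAddTorus (Fin 2) => (Xsm.onCircle (x 1) : ℂ)) q‖)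
    (hω2p : Summable fun q => wd₂ q * ‖mFourierCoeff (fun x : UnitAddTorus (Fin 2) => (Xp.onCircle (x 1) : ℂ)) q‖)
    (hω2s : Summable fun q => wd₂ q *
      ‖mFourierCoeff (fun x : UnitAddTorus (Fin 2) => ((Xp.onCircle (x 1) + Xm.onCircle (x 1) : ℝ) : ℂ)) q‖)
    -- profile data of the un-gauging (S-B)
    {D : ℕ → ℝ} (hDp : ∀ k y, |iteratedDeriv k Xp y| ≤ D k) (hDm : ∀ k y, |iteratedDeriv k Xm y| ≤ D k)
    {r : ℕ} (hr : 1 ≤ r) (R₀ : ℝ) (hone : ∀ n : ℤ, R₀ ≤ |(n : ℝ)| → ∀ k : Fin 2 → ℤ, k 0 = n → μ k = 1)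
    (bp bm : ℤ → ℤ) {β₀ : ℝ} (hβ0 : 0 ≤ β₀)
    (hβp : ∀ n : ℤ, |(n : ℝ)| < R₀ → |((bp n : ℤ) : ℝ) - n * (P.γ * 1)| ≤ β₀)
    (hβm : ∀ n : ℤ, |(n : ℝ)| < R₀ → |((bm n : ℤ) : ℝ) - n * (P.γ * (-1))| ≤ β₀)
    (Mμ : ℤ → ℝ → ℝ) (hMμc : ∀ n : ℤ, |(n : ℝ)| < R₀ → ContDiff ℝ r (Mμ n))
    (hμM : ∀ n : ℤ, |(n : ℝ)| < R₀ → ∀ k : Fin 2 → ℤ, k 0 = n → μ k = Mμ n (k 1))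
    {Cμ : ℕ → ℝ} (hCμ0 : ∀ α, 0 ≤ Cμ α)
    (hCμ : ∀ n : ℤ, |(n : ℝ)| < R₀ → ∀ α ≤ r, ∀ t, |iteratedDeriv α (Mμ n) t| ≤ Cμ α)
    (mf : ℤ → (Fin 2 → ℤ) → ℝ) (hmf : ∀ (n : ℤ) (k : Fin 2 → ℤ), k 0 = n → mf n k = m k)
    (hmf1 : ∀ n k, |mf n k| ≤ 1)
    (Np Nm : ℤ → ℝ → ℝ) (hNpc : ∀ n : ℤ, |(n : ℝ)| < R₀ → ContDiff ℝ r (Np n))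
    (hNmc : ∀ n : ℤ, |(n : ℝ)| < R₀ → ContDiff ℝ r (Nm n))
    (hmNp : ∀ n : ℤ, |(n : ℝ)| < R₀ → ∀ k : Fin 2 → ℤ, mf n (k - Pi.single 1 (bp n)) ^ 2 = Np n (k 1))
    (hmNm : ∀ n : ℤ, |(n : ℝ)| < R₀ → ∀ k : Fin 2 → ℤ, mf n (k - Pi.single 1 (bm n)) ^ 2 = Nm n (k 1))
    {CN : ℕ → ℝ} (hCN0 : ∀ α, 0 ≤ CN α)
    (hCNp : ∀ n : ℤ, |(n : ℝ)| < R₀ → ∀ α ≤ r, ∀ t, |iteratedDeriv α (Np n) t| ≤ CN α)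
    (hCNm : ∀ n : ℤ, |(n : ℝ)| < R₀ → ∀ α ≤ r, ∀ t, |iteratedDeriv α (Nm n) t| ≤ CN α)
    (hcomp_p : ∀ n : ℤ, |(n : ℝ)| < R₀ → ∀ k : Fin 2 → ℤ, k 0 = n → m (k - Pi.single 1 (bp n)) ^ 2 ≤ μ k ^ 2)
    (hcomp_m : ∀ n : ℤ, |(n : ℝ)| < R₀ → ∀ k : Fin 2 → ℤ, k 0 = n → m (k - Pi.single 1 (bm n)) ^ 2 ≤ μ k ^ 2)
    -- residual twist moments
    {AQ : ℝ} (hAQ : 0 ≤ AQ)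
    (hΘs : ∀ n : ℤ, |(n : ℝ)| < R₀ →
      Summable fun q => ‖mFourierCoeff (fun x : UnitAddTorus (Fin 2) => twist Qres n (x 1)) q‖)
    (hωs : ∀ n : ℤ, |(n : ℝ)| < R₀ →
      Summable fun q => wd q * ‖mFourierCoeff (fun x : UnitAddTorus (Fin 2) => twist Qres n (x 1)) q‖)
    (hAQn : ∀ n : ℤ, |(n : ℝ)| < R₀ →
      ∑' q, wd q * ‖mFourierCoeff (fun x : UnitAddTorus (Fin 2) => twist Qres n (x 1)) q‖ ≤ AQ) :
    ∑' k, m k ^ 2 * ‖mFourierCoeff (fun x => (w (tStart j + tHalf j) x : ℂ)) k‖ ^ 2 ≤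
      (Real.sqrt (∑' k, μ k ^ 2 * ‖mFourierCoeff (fun x => (w (tStart j) x : ℂ)) k‖ ^ 2) +
          (Real.sqrt ((∑' q, wd q * ‖mFourierCoeff (fun x : UnitAddTorus (Fin 2) => (Xsp.onCircle (x 1) : ℂ)) q‖) ^ 2 +
                (∑' q, wd q * ‖mFourierCoeff (fun x : UnitAddTorus (Fin 2) => (Xsm.onCircle (x 1) : ℂ)) q‖) ^ 2) +
              Real.sqrt ((2 * κ * tHalf j * C₂ + 4 * C₁ * Real.sqrt (κ * tHalf j / 2) +
                    Real.sqrt (P.γ * ε₁ * (5 + 6 * C₁ ^ 2 * κ * tHalf j)) +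
                    ((∑ α ∈ Finset.Ico 1 r, (∑ i ∈ Finset.range (α + 1), (α.choose i : ℝ) * (2 * Real.pi * β₀) ^ i *
                        D (α - i)) * (Cμ α / ((α ! : ℝ) * (2 * Real.pi) ^ α)) +
                      Cμ r / (r ! : ℝ) * ((∑ i ∈ Finset.range (r + 1 + 1), ((r + 1).choose i : ℝ) *
                        (2 * Real.pi * β₀) ^ i * D (r + 1 - i)) / (2 * Real.sqrt 3 * (2 * Real.pi) ^ r))) + AQ) +
                    Real.sqrt (2 * (CN r / (r ! : ℝ) * ((∑ i ∈ Finset.range (r + 1 + 1), ((r + 1).choose i : ℝ) *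
                        (2 * Real.pi * β₀) ^ i * D (r + 1 - i)) / (2 * Real.sqrt 3 * (2 * Real.pi) ^ r))))) ^ 2 +
                (2 * κ * tHalf j * C₂ + 4 * C₁ * Real.sqrt (κ * tHalf j / 2) +
                    Real.sqrt (P.γ * ε₁ * (5 + 6 * C₁ ^ 2 * κ * tHalf j)) +
                    ((∑ α ∈ Finset.Ico 1 r, (∑ i ∈ Finset.range (α + 1), (α.choose i : ℝ) * (2 * Real.pi * β₀) ^ i *
                        D (α - i)) * (Cμ α / ((α ! : ℝ) * (2 * Real.pi) ^ α)) +
                      Cμ r / (r ! : ℝ) * ((∑ i ∈ Finset.range (r + 1 + 1), ((r + 1).choose i : ℝ) *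
                        (2 * Real.pi * β₀) ^ i * D (r + 1 - i)) / (2 * Real.sqrt 3 * (2 * Real.pi) ^ r))) + AQ) +
                    Real.sqrt (2 * (CN r / (r ! : ℝ) * ((∑ i ∈ Finset.range (r + 1 + 1), ((r + 1).choose i : ℝ) *
                        (2 * Real.pi * β₀) ^ i * D (r + 1 - i)) / (2 * Real.sqrt 3 * (2 * Real.pi) ^ r))))) ^ 2)) *
            Real.sqrt (FluidPDE.Torus.scalarL2Sq (w 0))) ^ 2 +
        2 * ((∑' q, wd₂ q * ‖mFourierCoeff (fun x : UnitAddTorus (Fin 2) => (Xp.onCircle (x 1) : ℂ)) q‖) *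
          FluidPDE.Torus.scalarL2Sq (w 0)) +
        ((1 : ℝ) ^ 2 * (B ^ 2 * volume.real {x : UnitAddTorus (Fin 2) | Xp.onCircle (x 1) + Xm.onCircle (x 1) ≠ 1}) +
          2 * ((∑' q, wd₂ q *
              ‖mFourierCoeff (fun x : UnitAddTorus (Fin 2) => ((Xp.onCircle (x 1) + Xm.onCircle (x 1) : ℝ) : ℂ)) q‖) *
                FluidPDE.Torus.scalarL2Sq (w 0) +
            (1 : ℝ) ^ 2 * Real.sqrt (FluidPDE.Torus.scalarL2Sq (w 0)) *
              ((B / 4) * Real.sqrt (volume.real {x : UnitAddTorus (Fin 2) |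
                Xp.onCircle (x 1) + Xm.onCircle (x 1) ≠ 0 ∧ Xp.onCircle (x 1) + Xm.onCircle (x 1) ≠ 1})))) := by
  have h01 : (0 : Fin 2) ≠ 1 := by decide
  have hδj : 0 < P.δ j := P.δ_pos hδ₀ hd j
  -- range facts of the strip cut-offs
  have hε2 : ε ≤ 1 / 2 := by linarith
  have hXpm : ∀ y, Xp y * Xm y = 0 := fun y => by
    rw [hXp, hXm]; exact cutoff_mul_cutoff_neg_eq_zero (V := deriv (P.U j)) hε hε2 y
  have hXm1 : ∀ y, |Xm y| ≤ 1 := fun y => by rw [hXm]; exact abs_cutoff_le_one (fun y => -deriv (P.U j) y) ε y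
  have hXp1 : ∀ y, |Xp y| ≤ 1 := fun y => by rw [hXp]; exact abs_cutoff_le_one (deriv (P.U j)) ε y
  have hX01 : ∀ y, 0 ≤ Xp y + Xm y ∧ Xp y + Xm y ≤ 1 := fun y => by
    have h0p : 0 ≤ Xp y := by rw [hXp]; exact cutoff_nonneg (deriv (P.U j)) ε y
    have h0m : 0 ≤ Xm y := by rw [hXm]; exact cutoff_nonneg (fun y => -deriv (P.U j) y) ε y
    have hsq : Xp y ^ 2 + Xm y ^ 2 ≤ 1 := by
      rw [hXp, hXm]; exact cutoff_sq_add_cutoff_neg_sq_le_one (V := deriv (P.U j)) hε hε2 y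
    refine ⟨add_nonneg h0p h0m, ?_⟩
    nlinarith [hXpm y]
  -- flat-strip data of both families
  obtain ⟨hPUp, hXUp, -⟩ := cascade_flatStrip_data_pos P hδj hN hε hε' Ut hUt Xp hXp
  obtain ⟨hPUm, hXUm, -⟩ := cascade_flatStrip_data_neg P hδj hN hε hε' Ut hUt Xm hXm
  -- the true profile splits as `amp Ut γ + Qres`
  have hR : ∀ y, (amp ⟨P.U j, P.U_periodic j, P.contDiff_U hδj⟩ P.γ) y = (amp Ut P.γ) y + Qres y := fun y => by
    rw [amp_apply, amp_apply]; exact hQres y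
  -- residual leakage from the twist moments
  have hleak := leak_of_twist_moments (i := 0) (j := 1) Qres hμ1 hω0 hω R₀ hΘs hωs hAQn
  -- the two per-fibre estimates
  have hfib_p := fibre_estimate_of_profile_data' h01 (amp Ut P.γ) Qres
    (amp ⟨P.U j, P.U_periodic j, P.contDiff_U hδj⟩ P.γ) hR Xp Z hXp1 hZ hPUp hXUp hDp hr hm1 R₀ hone bp hβ0 hβp Mμ
    hMμc hμM hCμ0 hCμ mf hmf hmf1 Np hNpc hmNp hCN0 hCNp hcomp_p hAQ hleak
  have hfib_m := fibre_estimate_of_profile_data' h01 (amp Ut P.γ) Qres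
    (amp ⟨P.U j, P.U_periodic j, P.contDiff_U hδj⟩ P.γ) hR Xm Z hXm1 hZ hPUm hXUm hDm hr hm1 R₀ hone bm hβ0 hβm Mμ
    hMμc hμM hCμ0 hCμ mf hmf hmf1 Nm hNmc hmNm hCN0 hCNm hcomp_m hAQ hleak
  -- non-negativity of the constants
  have hD0 : ∀ k, 0 ≤ D k := fun k => (abs_nonneg _).trans (hDp k 0)
  have hBβ0 : ∀ α, 0 ≤ ∑ i ∈ Finset.range (α + 1), (α.choose i : ℝ) * (2 * Real.pi * β₀) ^ i * D (α - i) :=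
    fun α => Finset.sum_nonneg fun i _ => by have := hD0 (α - i); positivity
  have hA0 : 0 ≤ (∑ α ∈ Finset.Ico 1 r, (∑ i ∈ Finset.range (α + 1), (α.choose i : ℝ) * (2 * Real.pi * β₀) ^ i *
      D (α - i)) * (Cμ α / ((α ! : ℝ) * (2 * Real.pi) ^ α)) +
      Cμ r / (r ! : ℝ) * ((∑ i ∈ Finset.range (r + 1 + 1), ((r + 1).choose i : ℝ) *
        (2 * Real.pi * β₀) ^ i * D (r + 1 - i)) / (2 * Real.sqrt 3 * (2 * Real.pi) ^ r))) + AQ := by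
    refine add_nonneg (add_nonneg (Finset.sum_nonneg fun α _ => mul_nonneg (hBβ0 α)
      (div_nonneg (hCμ0 α) (by positivity))) (mul_nonneg (div_nonneg (hCμ0 r) (by positivity))
      (div_nonneg (hBβ0 _) (by positivity)))) hAQ
  have hC0 : 0 ≤ CN r / (r ! : ℝ) * ((∑ i ∈ Finset.range (r + 1 + 1), ((r + 1).choose i : ℝ) *
      (2 * Real.pi * β₀) ^ i * D (r + 1 - i)) / (2 * Real.sqrt 3 * (2 * Real.pi) ^ r)) :=
    mul_nonneg (div_nonneg (hCN0 r) (by positivity)) (div_nonneg (hBβ0 _) (by positivity))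
  -- the H half-slot of the ledger
  have h := ledger_step_H_of_moduli P hγ hδ₀ hd j Q hQ Xsp Xspd Xp Xsm Xsmd Xm Z hXspd hXsmd hκ hε₁ hγε hXsp1 hXsm1 hpart
    hC₁p hC₁m hC₂p hC₂m hflat_p hflat_m hXXs_p hXXs_m hZ hXpm hXm1 hX01 hw hB hμ1 hm1 hA0 hC0 hA0 hC0 hfib_p hfib_m
    hω0 hω hω20 hω2 hωp hωm hω2p hω2s
  exact h

end Cascade

end Summit.AnomalousDissipation.AnomalousDissipation.Theorems.SawtoothPulseCascade.K1Ledger
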